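import Mathlib
import Literature.Computability.Complexity.FixedDimILPPrograms
import Literature.Computability.Complexity.CodeFPArith
import Literature.Computability.Complexity.CodeFPBudgets
import Literature.Computability.Complexity.RowSelectFP
import Literature.Computability.QuantumComplexity.GramSchmidtTableMachine
import Literature.Algebra.EuclideanLattices.IntegerMatrixInverseMachine
import HarnessLib

/-!
# Lenstra's algorithm in fixed dimension, XII: the list program is polynomial time, part A (vertices, simplex)

Topic `Computability/Complexity`, grouping namespace `FixedDimILP`. Typed polynomial time (`CodeFP`,
`CodeFP*.lean`) for steps 1–3 of the list program of `FixedDimILPPrograms.lean`, for each FIXED dimension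
`N`: every loop over input data is a `map` / `all` / `filter` / `flatten` (polynomially bounded by
construction), every loop of length `N` is a loop over the CONSTANT list `range N`, and the arithmetic is the
tree's: `dotZ_codeFP`, `IntDetFP.detZ_codeFP`, `GSInverse.invData_codeFP`, `SimApproxLLL.prodFP`. No machine
and no growth estimate is written.

* generic: `tuplesL_codeFP` (all `k`-tuples, by induction on `k`), `rangeConstFP`;
* step 1–2: `thickenL_codeFP`, `satV_codeFP`, `satL_codeFP`, `coefMat_codeFP`, `solveNum_codeFP`,
  `vertexOf_codeFP`, **`verticesL_codeFP`**;
* step 3: `denomProd_codeFP`, `vertAt_codeFP`, `numer_codeFP`, `edgeRows_codeFP`, `invDataEdge_codeFP`,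
  `delta2_codeFP`, `gRows_codeFP`, `baryNum_codeFP`, `baryTest_codeFP`, `goodTuple_codeFP`, **`goodTuples_codeFP`**.

## References

* S. Arora, B. Barak, *Computational Complexity: A Modern Approach*, CUP 2009, §1.3 (polynomial time is
  closed under composition and polynomially bounded loops). [AroraBarak2009]
* H. W. Lenstra, Jr., Math. Oper. Res. 8 (1983), §2 remark (b) (the brute-force steps are polynomial for
  fixed `n`). [LenstraHW1983]
-/

namespace Literature.Computability.Complexity

namespace FixedDimILP

open _root_.Computability CodeFP Literature.Algebra.EuclideanLattices Literature.Algebra.EuclideanLattices.GSInverse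
  IntDetFP Literature.Computability.QuantumComplexity

/-! ### Codes -/

/-- The code of a list row `(a, β)`. [folklore] -/
abbrev rowE : LRow → List Bool := pairE (rawE intE) intE

/-- The code of a list vertex `(p, d)`. [folklore] -/
abbrev vertE : LVert → List Bool := pairE (rawE intE) natE

/-- The code of a list matrix. [folklore] -/
abbrev lmatE : List (List ℤ) → List Bool := rawE (rawE intE)

variable {σ α : Type} {eσ : σ → List Bool} {eα : α → List Bool}

/-! ### Generic combinators -/

/-- **All `k`-tuples are polynomial time for fixed `k`** (induction on `k`: `k + 1`-tuples are the
flattening of `a :: t` over `a ∈ l`, `t` a `k`-tuple). [cite: AroraBarak2009, §1.3] -/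
theorem tuplesL_codeFP (eα : α → List Bool) : ∀ k : ℕ, CodeFP (rawE eα) (rawE (rawE eα)) (tuplesL k)
  | 0 => const _ [[]]
  | k + 1 => by
    -- inner: `(a, T) ↦ T.map (a :: ·)`
    have hcons : CodeFP (pairE eα (rawE eα)) (rawE eα) (fun q => q.1 :: q.2) := rawCons eα
    have hinner : CodeFP (pairE eα (rawE (rawE eα))) (rawE (rawE eα)) (fun q => q.2.map fun t => q.1 :: t) :=
      (map (σ := α) (eσ := eα) (eα := rawE eα) (eβ := rawE eα) hcons :)
    -- outer: context `T = tuplesL k l`, items `a ∈ l`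
    have hg : CodeFP (pairE (rawE (rawE eα)) eα) (rawE (rawE eα)) (fun q => q.1.map fun t => q.2 :: t) :=
      (hinner.comp ((snd _ _).pair (fst _ _)) :)
    have houter : CodeFP (pairE (rawE (rawE eα)) (rawE eα)) (rawE (rawE (rawE eα)))
        (fun q => q.2.map fun a => q.1.map fun t => a :: t) :=
      (map (σ := List (List α)) (eσ := rawE (rawE eα)) (eα := eα) (eβ := rawE (rawE eα)) hg :)
    have hall : CodeFP (rawE eα) (rawE (rawE (rawE eα))) (fun l => l.map fun a => (tuplesL k l).map fun t => a :: t) :=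
      (houter.comp ((tuplesL_codeFP eα k).pair (CodeFP.id _)) :)
    exact ((flatten (rawE eα)).comp hall).congr fun l => rfl

/-- A constant list `range m`. [folklore] -/
theorem rangeConstFP (eσ : σ → List Bool) (m : ℕ) : CodeFP eσ (rawE natE) (fun _ => List.range m) := const _ _

/-- A constant unary count. [folklore] -/
theorem unConstFP (eσ : σ → List Bool) (m : ℕ) : CodeFP eσ unE (fun _ => m) := const _ _

/-- `getD` on raw integer lists with default `0` (context: the index). [folklore] -/
theorem getDIntFP : CodeFP (pairE (rawE intE) natE) intE (fun q => q.1.getD q.2 0) :=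
  ((rawGetOr intE).comp ((fst _ _).pair ((snd _ _).pair (const _ (0 : ℤ))))).congr fun _ => rfl

/-! ### Steps 1–2: thickening, satisfaction, the exact solver, vertices -/

/-- Step 1 on codes. [cite: AroraBarak2009, §1.3] -/
theorem thickenL_codeFP : CodeFP (rawE rowE) (rawE rowE) thickenL := by
  have hrow : CodeFP rowE rowE (fun r => (r.1.map (2 * ·), 2 * r.2 + 1)) := by
    have h2 : CodeFP rowE (rawE intE) (fun r => r.1.map (2 * ·)) :=
      ((map₀ (intMul.comp ((const intE (2 : ℤ)).pair (CodeFP.id intE)))).comp (fst _ _) :)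
    have h3 : CodeFP rowE intE (fun r => 2 * r.2 + 1) :=
      (intAdd.comp ((intMul.comp ((const _ (2 : ℤ)).pair (snd _ _))).pair (const _ (1 : ℤ))) :)
    exact h2.pair h3
  exact (map₀ hrow).congr fun _ => rfl

/-- `satV` on codes: `(rows, v) ↦ rows.all (a · p ≤ β d)`. [cite: AroraBarak2009, §1.3] -/
theorem satV_codeFP : CodeFP (pairE (rawE rowE) vertE) bitE (fun q => satV q.1 q.2) := by
  have hitem : CodeFP (pairE vertE rowE) bitE (fun q => decide (dotZ q.2.1 q.1.1 ≤ q.2.2 * q.1.2)) :=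
    (intLe.comp ((dotZ_codeFP.comp ((snd _ _).fst'.pair (fst _ _).fst')).pair
      (intMul.comp ((snd _ _).snd'.pair (intOfNat.comp (fst _ _).snd')))) :)
  have hall := all (σ := LVert) (eσ := vertE) (eα := rowE) hitem
  exact (hall.comp ((snd _ _).pair (fst _ _))).congr fun q => by simp [satV]

/-- `satL` on codes: `(rows, x) ↦ rows.all (a · x ≤ β)`. [cite: AroraBarak2009, §1.3] -/
theorem satL_codeFP : CodeFP (pairE (rawE rowE) (rawE intE)) bitE (fun q => satL q.1 q.2) := by
  have hitem : CodeFP (pairE (rawE intE) rowE) bitE (fun q => decide (dotZ q.2.1 q.1 ≤ q.2.2)) :=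
    (intLe.comp ((dotZ_codeFP.comp ((snd _ _).fst'.pair (fst _ _))).pair (snd _ _).snd') :)
  have hall := all (σ := List ℤ) (eσ := rawE intE) (eα := rowE) hitem
  exact (hall.comp ((snd _ _).pair (fst _ _))).congr fun q => by simp [satL]

/-- `coefMat` on codes. [folklore] -/
theorem coefMat_codeFP : CodeFP (rawE rowE) lmatE coefMat := (map₀ (fst _ _)).congr fun _ => rfl

/-- The exact solver on codes: `S ↦ ((G b)ₜ)ₜ`. [cite: Cohen1993, §2.6.3] [cite: AroraBarak2009, §1.3] -/
theorem solveNum_codeFP : CodeFP (rawE rowE) (rawE intE) solveNum := by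
  -- context `(invCols (coefMat S), S.map snd)`, item `t`
  have hctx : CodeFP (rawE rowE) (pairE lmatE (rawE intE)) (fun S => (invCols (coefMat S), S.map Prod.snd)) :=
    (((invData_codeFP.comp coefMat_codeFP).snd').pair (map₀ (snd _ _)) :)
  -- row `t` of `G`: `cols.map (·.getD t 0)`
  have hcol : CodeFP (pairE natE (rawE intE)) intE (fun q => q.2.getD q.1 0) :=
    (getDIntFP.comp ((snd _ _).pair (fst _ _)) :)
  have hrowG : CodeFP (pairE natE lmatE) (rawE intE) (fun q => q.2.map fun col => col.getD q.1 0) :=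
    (map (σ := ℕ) (eσ := natE) (eα := rawE intE) (eβ := intE) hcol :)
  have hitem : CodeFP (pairE (pairE lmatE (rawE intE)) natE) intE
      (fun q => dotZ (q.1.1.map fun col => col.getD q.2 0) q.1.2) :=
    (dotZ_codeFP.comp ((hrowG.comp ((snd _ _).pair (fst _ _).fst')).pair (fst _ _).snd') :)
  have hmap := map (σ := List (List ℤ) × List ℤ) (eσ := pairE lmatE (rawE intE)) (eα := natE) (eβ := intE) hitem
  have hrange : CodeFP (rawE rowE) (rawE natE) (fun S => List.range S.length) := (urange.comp (ulength rowE) :)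
  exact ((hmap.comp (hctx.pair hrange)).congr fun S => rfl)

/-- `vertexOf` on codes. [folklore] -/
theorem vertexOf_codeFP : CodeFP (rawE rowE) vertE vertexOf :=
  (solveNum_codeFP.pair (intToNat.comp (invData_codeFP.comp coefMat_codeFP).fst')).congr fun _ => rfl

/-- **Step 2 on codes**: the vertex list, for fixed `N`. [cite: LenstraHW1983, §2 remark (b)] [cite: AroraBarak2009, §1.3] -/
theorem verticesL_codeFP (N : ℕ) : CodeFP (rawE rowE) (rawE vertE) (verticesL N) := by
  have hpred : CodeFP (pairE (rawE rowE) (rawE rowE)) bitE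
      (fun q => decide (detZ (coefMat q.2) ≠ 0) && satV q.1 (vertexOf q.2)) := by
    have hdet : CodeFP (pairE (rawE rowE) (rawE rowE)) bitE (fun q => decide (detZ (coefMat q.2) ≠ 0)) :=
      ((intEq.comp ((detZ_codeFP.comp (coefMat_codeFP.comp (snd _ _))).pair (const _ (0 : ℤ)))).not.congr fun q => by
        simp only [ne_eq, decide_not])
    have hsat : CodeFP (pairE (rawE rowE) (rawE rowE)) bitE (fun q => satV q.1 (vertexOf q.2)) :=
      (satV_codeFP.comp ((fst _ _).pair (vertexOf_codeFP.comp (snd _ _))) :)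
    exact hdet.and hsat
  have hfilter := RowSelectFP.filter_codeFP (σ := List LRow) (eσ := rawE rowE) (eα := rawE rowE) hpred
  have hfil : CodeFP (rawE rowE) (rawE (rawE rowE))
      (fun rows' => (tuplesL N rows').filter fun S => decide (detZ (coefMat S) ≠ 0) && satV rows' (vertexOf S)) :=
    (hfilter.comp ((CodeFP.id _).pair (tuplesL_codeFP rowE N)) :)
  exact ((map₀ vertexOf_codeFP).comp hfil).congr fun _ => rfl

/-! ### Step 3: the simplex search -/

/-- The code of a candidate tuple (a list of vertices). [folklore] -/
abbrev candE : List LVert → List Bool := rawE vertE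

/-- `denomProd` on codes. [folklore] -/
theorem denomProd_codeFP : CodeFP candE natE denomProd := (SimApproxLLL.prodFP.comp (map₀ (snd _ _))).congr fun _ => rfl

/-- `vertAt` on codes (index from the context). [folklore] -/
theorem vertAt_codeFP : CodeFP (pairE candE natE) vertE (fun q => vertAt q.1 q.2) :=
  ((rawGetOr vertE).comp ((fst _ _).pair ((snd _ _).pair (const _ (([], 0) : LVert))))).congr fun _ => rfl

/-- `numer` on codes: `(cand, i) ↦ (D / dᵢ) pᵢ`. [cite: AroraBarak2009, §1.3] -/
theorem numer_codeFP : CodeFP (pairE candE natE) (rawE intE) (fun q => numer q.1 q.2) := by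
  have hv := vertAt_codeFP
  have hfac : CodeFP (pairE candE natE) intE (fun q => ((denomProd q.1 / (vertAt q.1 q.2).2 : ℕ) : ℤ)) :=
    (intOfNat.comp (natDiv.comp ((denomProd_codeFP.comp (fst _ _)).pair hv.snd')) :)
  have hitem : CodeFP (pairE intE intE) intE (fun q => q.1 * q.2) := intMul
  have hmap := map (σ := ℤ) (eσ := intE) (eα := intE) (eβ := intE) hitem
  exact ((hmap.comp (hfac.pair hv.fst')).congr fun q => rfl)

/-- `edgeRows N` on codes: rows `Pᵢ₊₁ - P₀` over the constant index lists. [cite: AroraBarak2009, §1.3] -/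
theorem edgeRows_codeFP (N : ℕ) : CodeFP candE lmatE (edgeRows N) := by
  -- item `(ctx = (P_{i+1}, P₀), j) ↦ P_{i+1}[j] - P₀[j]`
  have hentry : CodeFP (pairE (pairE (rawE intE) (rawE intE)) natE) intE
      (fun q => q.1.1.getD q.2 0 - q.1.2.getD q.2 0) :=
    (intSub.comp ((getDIntFP.comp ((fst _ _).fst'.pair (snd _ _))).pair (getDIntFP.comp ((fst _ _).snd'.pair (snd _ _)))) :)
  have hrowmap := map (σ := List ℤ × List ℤ) (eσ := pairE (rawE intE) (rawE intE)) (eα := natE) (eβ := intE) hentry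
  -- row `i`: context `cand`, item `i`
  have hrow : CodeFP (pairE candE natE) (rawE intE)
      (fun q => (List.range N).map fun j => (numer q.1 (q.2 + 1)).getD j 0 - (numer q.1 0).getD j 0) := by
    have hP1 : CodeFP (pairE candE natE) (rawE intE) (fun q => numer q.1 (q.2 + 1)) :=
      (numer_codeFP.comp ((fst _ _).pair (natAdd.comp ((snd _ _).pair (const _ 1)))) :)
    have hP0 : CodeFP (pairE candE natE) (rawE intE) (fun q => numer q.1 0) :=
      (numer_codeFP.comp ((fst _ _).pair (const _ 0)) :)
    exact ((hrowmap.comp ((hP1.pair hP0).pair (rangeConstFP _ N))).congr fun q => rfl)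
  have hrows := map (σ := List LVert) (eσ := candE) (eα := natE) (eβ := rawE intE) hrow
  exact ((hrows.comp ((CodeFP.id _).pair (rangeConstFP _ N))).congr fun cand => rfl)

/-- `(invDen, invCols)` of the edge matrix on codes. [cite: Cohen1993, §2.6.3] -/
theorem invDataEdge_codeFP (N : ℕ) : CodeFP candE (pairE intE lmatE) (fun cand => (invDen (edgeRows N cand), invCols (edgeRows N cand))) :=
  (invData_codeFP.comp (edgeRows_codeFP N) :)

/-- `delta2 N` on codes. [folklore] -/
theorem delta2_codeFP (N : ℕ) : CodeFP candE intE (delta2 N) := ((invDataEdge_codeFP N).fst').congr fun _ => rfl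

/-- `gRows N` on codes (the transposed `invCols`). [folklore] -/
theorem gRows_codeFP (N : ℕ) : CodeFP candE lmatE (gRows N) := by
  have hcol : CodeFP (pairE natE (rawE intE)) intE (fun q => q.2.getD q.1 0) := (getDIntFP.comp ((snd _ _).pair (fst _ _)) :)
  have hrowG : CodeFP (pairE natE lmatE) (rawE intE) (fun q => q.2.map fun col => col.getD q.1 0) :=
    (map (σ := ℕ) (eσ := natE) (eα := rawE intE) (eβ := intE) hcol :)
  have hitem : CodeFP (pairE lmatE natE) (rawE intE) (fun q => q.1.map fun col => col.getD q.2 0) :=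
    (hrowG.comp ((snd _ _).pair (fst _ _)) :)
  have hmap := map (σ := List (List ℤ)) (eσ := lmatE) (eα := natE) (eβ := rawE intE) hitem
  exact ((hmap.comp ((invDataEdge_codeFP N).snd'.pair (rangeConstFP _ N))).congr fun cand => rfl)

/-- `baryNum N` on codes: `(cand, v) ↦ ((D p - d P₀) · colₖ)ₖ`. [cite: AroraBarak2009, §1.3] -/
theorem baryNum_codeFP (N : ℕ) : CodeFP (pairE candE vertE) (rawE intE) (fun q => baryNum N q.1 q.2) := by
  let C := pairE candE vertE
  -- the vector `w = (D vⱼ - d (P₀)ⱼ)ⱼ`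
  have hD : CodeFP C intE (fun q => (denomProd q.1 : ℤ)) := (intOfNat.comp (denomProd_codeFP.comp (fst _ _)) :)
  have hd : CodeFP C intE (fun q => (q.2.2 : ℤ)) := (intOfNat.comp (snd _ _).snd' :)
  have hP0 : CodeFP C (rawE intE) (fun q => numer q.1 0) := (numer_codeFP.comp ((fst _ _).pair (const _ 0)) :)
  have hentry : CodeFP (pairE (pairE (pairE intE intE) (pairE (rawE intE) (rawE intE))) natE) intE
      (fun q => q.1.1.1 * q.1.2.1.getD q.2 0 - q.1.1.2 * q.1.2.2.getD q.2 0) :=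
    (intSub.comp ((intMul.comp ((fst _ _).fst'.fst'.pair (getDIntFP.comp ((fst _ _).snd'.fst'.pair (snd _ _))))).pair
      (intMul.comp ((fst _ _).fst'.snd'.pair (getDIntFP.comp ((fst _ _).snd'.snd'.pair (snd _ _)))))) :)
  have hwmap := map (σ := (ℤ × ℤ) × (List ℤ × List ℤ)) (eσ := pairE (pairE intE intE) (pairE (rawE intE) (rawE intE)))
    (eα := natE) (eβ := intE) hentry
  have hw : CodeFP C (rawE intE)
      (fun q => (List.range N).map fun j => (denomProd q.1 : ℤ) * q.2.1.getD j 0 - (q.2.2 : ℤ) * (numer q.1 0).getD j 0) :=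
    ((hwmap.comp (((hD.pair hd).pair ((snd _ _).fst'.pair hP0)).pair (rangeConstFP _ N))).congr fun q => rfl)
  -- dot with every column
  have hdot : CodeFP (pairE (rawE intE) (rawE intE)) intE (fun q => dotZ q.1 q.2) := dotZ_codeFP
  have hcols := map (σ := List ℤ) (eσ := rawE intE) (eα := rawE intE) (eβ := intE) hdot
  exact ((hcols.comp (hw.pair ((invDataEdge_codeFP N).comp (fst _ _)).snd')).congr fun q => rfl)

/-- `baryTest N` on codes. [folklore] -/
theorem baryTest_codeFP (N : ℕ) : CodeFP (pairE candE vertE) bitE (fun q => baryTest N q.1 q.2) := by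
  let C := pairE candE vertE
  have hq : CodeFP C (rawE intE) (fun q => baryNum N q.1 q.2) := baryNum_codeFP N
  have hm : CodeFP C intE (fun q => delta2 N q.1 * q.2.2) :=
    (intMul.comp (((delta2_codeFP N).comp (fst _ _)).pair (intOfNat.comp (snd _ _).snd')) :)
  have hitem : CodeFP (pairE intE intE) bitE (fun p => decide (|p.2| ≤ p.1)) := (intLe.comp ((intAbs.comp (snd _ _)).pair (fst _ _)) :)
  have hall : CodeFP C bitE (fun q => (baryNum N q.1 q.2).all fun z => decide (|z| ≤ delta2 N q.1 * q.2.2)) :=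
    ((all (σ := ℤ) (eσ := intE) (eα := intE) hitem).comp (hm.pair hq) :)
  have hlast : CodeFP C bitE (fun q => decide (|delta2 N q.1 * q.2.2 - (baryNum N q.1 q.2).sum| ≤ delta2 N q.1 * q.2.2)) :=
    (intLe.comp ((intAbs.comp (intSub.comp (hm.pair (intSum.comp hq)))).pair hm) :)
  exact (hall.and hlast).congr fun q => rfl

/-- `goodTuple N` on codes: `(V, cand) ↦ [detZ W̃ ≠ 0] ∧ V.all (baryTest cand)`. [folklore] -/
theorem goodTuple_codeFP (N : ℕ) : CodeFP (pairE (rawE vertE) candE) bitE (fun q => goodTuple N q.1 q.2) := by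
  have hdet : CodeFP (pairE (rawE vertE) candE) bitE (fun q => decide (detZ (edgeRows N q.2) ≠ 0)) :=
    ((intEq.comp ((detZ_codeFP.comp ((edgeRows_codeFP N).comp (snd _ _))).pair (const _ (0 : ℤ)))).not.congr fun q => by
      simp only [ne_eq, decide_not])
  have hall : CodeFP (pairE (rawE vertE) candE) bitE (fun q => q.1.all (baryTest N q.2)) :=
    ((all (σ := List LVert) (eσ := candE) (eα := vertE) (baryTest_codeFP N)).comp ((snd _ _).pair (fst _ _)) :)
  exact (hdet.and hall).congr fun q => rfl

/-- **Step 3 on codes**: the good `(N+1)`-tuples of vertices. [cite: LenstraHW1983, §2] [cite: AroraBarak2009, §1.3] -/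
theorem goodTuples_codeFP (N : ℕ) : CodeFP (rawE vertE) (rawE candE) (goodTuples N) := by
  have hfilter := RowSelectFP.filter_codeFP (σ := List LVert) (eσ := rawE vertE) (eα := candE) (goodTuple_codeFP N)
  exact (hfilter.comp ((CodeFP.id _).pair (tuplesL_codeFP vertE (N + 1)))).congr fun V => rfl

end FixedDimILP

end Literature.Computability.Complexity
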